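import Summits.CriticalPhenomena.PercolationContinuityZ3.Theorems.SahiMasterFamilyStrictHarris

/-!
# The master equality statement for DECREASING events (the percolation separations), `k ≤ 2` proved

Companion of `SahiMasterFamily.lean` / `SahiMasterFamilyStrictHarris.lean` (crux `NoHeavyLowerTail`,
stmt-CriticalPhenomena-4575; unit `prim-master-conj`).  The one-cut rows are stated on group SEPARATIONS
`D[X|Y] = {no open X–Y path}`, which are decreasing events; this file records the decreasing form of the conjectured
equality locus, `MasterFamilyEqIffLower k`: for `p` in the open cube and `k` decreasing events `D`,
`E_k(μ_p; 1_{D_0},…,1_{D_{k−1}}) = 0 ↔ D ∈ Z_k` (`SuppZeroFlag k D`, the same recursive zero-flag class — intersections of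
decreasing events are decreasing, and the class is `p`-free).  PROVED: `⇐` for every `k` (`masterFamilyEqIff_mpr` of
`SahiMasterFamily.lean`, which needs no monotonicity), `k = 0, 1`, and `k = 2` (strict Harris transported through complements:
`Cov(1_{D}, 1_{D'}) = Cov(1_{Dᶜ}, 1_{D'ᶜ})` and `Dᶜ` is increasing).  OPEN (our conjecture) for `k ≥ 3`, with the same census
evidence as the increasing form (the cube censuses are symmetric under `p ↦ 1 − p` / complementation; the graph censuses
ARE the decreasing form). [this work]
-/

noncomputable section

open scoped Classical

namespace Summit.CriticalPhenomena.PercolationContinuityZ3.Theorems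

open Finset Function MeasureTheory
open Literature.Combinatorics.Sahi2008
open Literature.Probability.Percolation (DeterminedBy determinedBy_iff)
open Literature.Probability.Percolation.DecisionTree (ind ind_of_mem ind_of_not_mem ind_nonneg)

/-- **Master family, equality half, decreasing events** (OUR CONJECTURE for `k ≥ 3`): for every finite `ι`, every `p` in
the open cube `(0,1)^ι` and every `k` decreasing events `D_j`, `E_k(μ_p; 1_{D_0},…,1_{D_{k−1}}) = 0 ↔ D ∈ Z_k`
(`SuppZeroFlag k D`).  `⇐` all `k` and `⇔` for `k ≤ 2` are theorems below.  Never a fact. [this work]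
[status: open for k ≥ 3] -/
@[conjecture] def MasterFamilyEqIffLower (k : ℕ) : Prop :=
  ∀ (ι : Type) [Fintype ι] (p : ι → unitInterval), (∀ e, (p e : ℝ) ∈ Set.Ioo (0 : ℝ) 1) →
    ∀ D : Fin k → Set (Set ι), (∀ j, IsLowerSet (D j)) →
      (sahiE (bernoulliWeight p) k (fun j => ind (D j)) = 0 ↔ SuppZeroFlag k D)

section Complements

variable {ι : Type*} [Fintype ι]

omit [Fintype ι] in
/-- `1_{Aᶜ} = 1 − 1_A`. [folklore] -/
theorem ind_compl_apply (A : Set (Set ι)) (ω : Set ι) : ind Aᶜ ω = 1 - ind A ω := by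
  by_cases h : ω ∈ A
  · rw [ind_of_mem h, ind_of_not_mem (Set.notMem_compl_iff.2 h)]; norm_num
  · rw [ind_of_not_mem h, ind_of_mem (Set.mem_compl h)]; norm_num

/-- Complementing both events does not change the covariance (probability weight). [folklore] -/
theorem cov_ind_compl_compl (p : ι → unitInterval) (A B : Set (Set ι)) :
    ex (bernoulliWeight p) (ind Aᶜ * ind Bᶜ) - ex (bernoulliWeight p) (ind Aᶜ) * ex (bernoulliWeight p) (ind Bᶜ) =
      ex (bernoulliWeight p) (ind A * ind B) - ex (bernoulliWeight p) (ind A) * ex (bernoulliWeight p) (ind B) := by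
  have h1 := sum_bernoulliWeight p
  have eA : ind Aᶜ = (fun _ => (1 : ℝ)) + (-1 : ℝ) • ind A := by
    funext ω; simp only [ind_compl_apply, Pi.add_apply, Pi.smul_apply, smul_eq_mul]; ring
  have eB : ind Bᶜ = (fun _ => (1 : ℝ)) + (-1 : ℝ) • ind B := by
    funext ω; simp only [ind_compl_apply, Pi.add_apply, Pi.smul_apply, smul_eq_mul]; ring
  have eAB : ind Aᶜ * ind Bᶜ = (fun _ => (1 : ℝ)) + ((-1 : ℝ) • ind A + ((-1 : ℝ) • ind B + ind A * ind B)) := by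
    funext ω; simp only [ind_compl_apply, Pi.add_apply, Pi.mul_apply, Pi.smul_apply, smul_eq_mul]; ring
  rw [eAB, ex_add, ex_add, ex_add, ex_smul, ex_smul, ex_const h1, eA, eB, ex_add, ex_add, ex_smul, ex_smul,
    ex_const h1]
  ring

omit [Fintype ι] in
/-- An event is determined by `S` iff its complement is. [folklore] -/
theorem determinedBy_of_compl {A : Set (Set ι)} {S : Set ι} (h : DeterminedBy Aᶜ S) : DeterminedBy A S := by
  rw [determinedBy_iff] at h ⊢
  intro ω ω' hωω'
  have := h ω ω' hωω'
  simp only [Set.mem_compl_iff, not_iff_not] at this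
  exact this

/-- **Strict Harris for decreasing events**: in the open cube, two decreasing events with `P(D ∩ D') = P(D)P(D')` are
determined by disjoint finite sets of coordinates. [this work] -/
theorem disjoint_determinedBy_of_real_inter_eq_lower (p : ι → unitInterval)
    (hp : ∀ e, (p e : ℝ) ∈ Set.Ioo (0 : ℝ) 1) {A B : Set (Set ι)} (hA : IsLowerSet A) (hB : IsLowerSet B)
    (hAB : ex (bernoulliWeight p) (ind A * ind B) = ex (bernoulliWeight p) (ind A) * ex (bernoulliWeight p) (ind B)) :
    ∃ S T : Finset ι, Disjoint S T ∧ DeterminedBy A (↑S : Set ι) ∧ DeterminedBy B (↑T : Set ι) := by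
  have hc : ex (bernoulliWeight p) (ind Aᶜ * ind Bᶜ) =
      ex (bernoulliWeight p) (ind Aᶜ) * ex (bernoulliWeight p) (ind Bᶜ) := by
    have := cov_ind_compl_compl p A B
    rw [hAB, sub_self] at this
    exact sub_eq_zero.1 this
  obtain ⟨S, T, hST, hS, hT⟩ :=
    disjoint_determinedBy_of_real_inter_eq p hp hA.compl hB.compl hc
  exact ⟨S, T, hST, determinedBy_of_compl hS, determinedBy_of_compl hT⟩

end Complements

/-- `MasterFamilyEqIffLower 0` (vacuous). [this work] -/
theorem masterFamilyEqIffLower_zero : MasterFamilyEqIffLower 0 := fun ι _ p _ D _ =>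
  ⟨fun _ => trivial, fun h => masterFamilyEqIff_mpr 0 ι p D h⟩

/-- `MasterFamilyEqIffLower 1`: `P(D) = 0 ↔ D = ∅` in the open cube. [this work] -/
theorem masterFamilyEqIffLower_one : MasterFamilyEqIffLower 1 := by
  intro ι _ p hp D _
  refine ⟨fun h => ?_, fun h => masterFamilyEqIff_mpr 1 ι p D h⟩
  show D 0 = ∅
  rw [sahiE_one_apply, ex,
    Finset.sum_eq_zero_iff_of_nonneg fun ω _ => mul_nonneg (bernoulliWeight_pos hp ω).le (ind_nonneg _ _)] at h
  ext ω
  simp only [Set.mem_empty_iff_false, iff_false]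
  intro hω
  have h1 := h ω (Finset.mem_univ ω)
  rw [ind_of_mem hω, mul_one] at h1
  exact (bernoulliWeight_pos hp ω).ne' h1

/-- **`MasterFamilyEqIffLower 2` holds**: for two decreasing events in the open cube, `E_2 = Cov = 0` iff they are
determined by disjoint coordinate sets — strict Harris through complements. [this work] -/
theorem masterFamilyEqIffLower_two : MasterFamilyEqIffLower 2 := by
  intro ι _ p hp D hD
  refine ⟨fun h => ?_, fun h => masterFamilyEqIff_mpr 2 ι p D h⟩
  rw [sahiE_two_apply, sub_eq_zero] at h
  exact disjoint_determinedBy_of_real_inter_eq_lower p hp (hD 0) (hD 1) h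

/-- The decreasing-events master equality statement holds for every `k ≤ 2`. [this work] -/
theorem masterFamilyEqIffLower_of_le_two {k : ℕ} (hk : k ≤ 2) : MasterFamilyEqIffLower k := by
  interval_cases k
  · exact masterFamilyEqIffLower_zero
  · exact masterFamilyEqIffLower_one
  · exact masterFamilyEqIffLower_two

/-! ### The graph form: group separations -/

section Graph

open Literature.Probability.Percolation

variable {V : Type} [Fintype V]

/-- **The percolation rows' equality face, proved direction**: for any `k` group separations
`D_j = {X_j ↮ Y_j}` of a finite weighted graph (edge weights in `[0,1]`) lying in the zero-flag class `Z_k` (computed on the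
edge cube `Set (Sym2 V)`), `E_k(D_0,…,D_{k−1}) = 0`. [this work] -/
theorem sahiE_groupSep_eq_zero_of_suppZeroFlag (w : Sym2 V → unitInterval) {k : ℕ} (X Y : Fin k → Set V)
    (hZ : SuppZeroFlag k fun j => {ω : BondConfig V | ∀ x ∈ X j, ∀ y ∈ Y j, ¬ (openGraph ω).Reachable x y}) :
    sahiE (bernoulliWeight w) k
      (fun j => ind {ω : BondConfig V | ∀ x ∈ X j, ∀ y ∈ Y j, ¬ (openGraph ω).Reachable x y}) = 0 :=
  sahiE_ind_eq_zero_of_suppZeroFlag w hZ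

/-- The conjectured converse for group separations is an instance of `MasterFamilyEqIffLower k` (separations are
decreasing, `isLowerSet_groupSep`). [this work] -/
theorem sahiE_groupSep_eq_zero_iff_of_masterFamilyEqIffLower {k : ℕ} (h : MasterFamilyEqIffLower k)
    (w : Sym2 V → unitInterval) (hw : ∀ e, (w e : ℝ) ∈ Set.Ioo (0 : ℝ) 1) (X Y : Fin k → Set V) :
    sahiE (bernoulliWeight w) k
        (fun j => ind {ω : BondConfig V | ∀ x ∈ X j, ∀ y ∈ Y j, ¬ (openGraph ω).Reachable x y}) = 0 ↔
      SuppZeroFlag k fun j => {ω : BondConfig V | ∀ x ∈ X j, ∀ y ∈ Y j, ¬ (openGraph ω).Reachable x y} :=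
  h (Sym2 V) w hw _ fun j => isLowerSet_groupSep (X j) (Y j)

end Graph

end Summit.CriticalPhenomena.PercolationContinuityZ3.Theorems
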